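import Mathlib
import Summits.ValiantsHypothesis.ValiantsHypothesis.Theorems.LacunarySymmetroidMatrixDescartesDetLorentzianPencilTwo

/-!
# ValiantsHypothesis / LacunarySymmetroid — crux `MatrixDescartes` (stmt-ValiantsHypothesis-18050), line
# `lorentzian_shadow` :: `stub_detLorentzian`: clause (d) for `K = 2` — the SEMIDEFINITE closure

Helper file (`--supports stmt-ValiantsHypothesis-18050 --as helper`; cell val-lit, seat val-lit-p5 g9, merged desk
RULING #91 [L4]).  Closes NO item; theorem-only, 0 facts.  «V1 line helper; `MatrixDescartes` / Conjecture B /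
`VP ≠ VNP` OPEN.»

`…DetLorentzianPencilTwo` proved clause (d) of `IsLorentzianArray m 2 (detArray m 2 A)` for positive DEFINITE pairs.
The stub quantifies over positive SEMIdefinite tuples; clause (d) is a closed condition, so it passes to the limit
`A_l + ε·1 → A_l`:

* `coeff_det_pencil_perturb_continuous` — `ε ↦ coeff_j det (X • (A₀ + ε E₀) + (A₁ + ε E₁))` is a polynomial
  function of `ε` (bivariate trick: evaluate `det` over `ℝ[X][Y]` at `Y = C ε`), hence continuous;
* `det_hess_nonpos_of_posDef` — for definite pairs the `2 × 2` Hessian blocks have `det ≤ 0` (from the landed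
  `PencilTwo.atMostOnePosEig_hessAt_detArray_pencilTwo` tested on the coordinate vectors, diagonal entries `≥ 0`);
* **`atMostOnePosEig_hessAt_detArray_pencilTwo_semidef`** — CLAUSE (d) FOR `K = 2`, ALL `m`, positive
  SEMIDEFINITE `A₀, A₁` (the stub's hypothesis), in the line's unfolded currency.

Residual of `stub_detLorentzian` after this: clause (d) for `K ≥ 3` (with `m ≥ 3`; Gårding / Brändén–Huh).
-/

set_option linter.dupNamespace false

namespace Summit.ValiantsHypothesis.ValiantsHypothesis.Theorems.LacunarySymmetroidMatrixDescartes

open Polynomial Matrix Finset Filter Topology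

namespace PencilTwo

variable {m : ℕ}

/-! ## 1. Coefficients of the perturbed pencil determinant are polynomial in `ε` -/

/-- The perturbed pencil determinant is the evaluation at `Y = C ε` of a fixed polynomial over `ℝ[X]`. -/
theorem det_pencil_perturb_eq_eval (A₀ A₁ E₀ E₁ : Matrix (Fin m) (Fin m) ℝ) (ε : ℝ) :
    ((X : ℝ[X]) • (A₀ + ε • E₀).map C + (A₁ + ε • E₁).map C).det =
      (((X : ℝ[X]) • A₀.map C + A₁.map C).map (Polynomial.C : ℝ[X] →+* ℝ[X][X]) +
          (X : ℝ[X][X]) • ((X : ℝ[X]) • E₀.map C + E₁.map C).map (Polynomial.C : ℝ[X] →+* ℝ[X][X])).det.eval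
        (Polynomial.C ε) := by
  rw [← Polynomial.coe_evalRingHom, RingHom.map_det]
  congr 1
  ext i j
  simp only [RingHom.mapMatrix_apply, Matrix.map_apply, Matrix.add_apply, Matrix.smul_apply, smul_eq_mul,
    Polynomial.coe_evalRingHom, eval_add, eval_mul, eval_C, eval_X, map_add, map_mul]
  ring

/-- `ε ↦ coeff_j det (X • (A₀ + ε E₀) + (A₁ + ε E₁))` is continuous (indeed polynomial in `ε`). -/
theorem coeff_det_pencil_perturb_continuous (A₀ A₁ E₀ E₁ : Matrix (Fin m) (Fin m) ℝ) (j : ℕ) :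
    Continuous fun ε : ℝ => ((X : ℝ[X]) • (A₀ + ε • E₀).map C + (A₁ + ε • E₁).map C).det.coeff j := by
  set D := (((X : ℝ[X]) • A₀.map C + A₁.map C).map (Polynomial.C : ℝ[X] →+* ℝ[X][X]) +
    (X : ℝ[X][X]) • ((X : ℝ[X]) • E₀.map C + E₁.map C).map (Polynomial.C : ℝ[X] →+* ℝ[X][X])).det with hD
  have hfun : (fun ε : ℝ => ((X : ℝ[X]) • (A₀ + ε • E₀).map C + (A₁ + ε • E₁).map C).det.coeff j) =
      fun ε : ℝ => ∑ i ∈ Finset.range (D.natDegree + 1), (D.coeff i).coeff j * ε ^ i := by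
    funext ε
    rw [det_pencil_perturb_eq_eval, ← hD, eval_eq_sum_range, finsetSum_coeff]
    refine Finset.sum_congr rfl fun i _ => ?_
    rw [← map_pow, coeff_mul_C]
  rw [hfun]
  exact continuous_finsetSum _ fun i _ => continuous_const.mul (continuous_pow i)

/-! ## 2. Determinant of the Hessian blocks: definite case, from the landed clause (d) -/

/-- For definite pairs, each Hessian block (in the line's currency) has `H₀₀ H₁₁ - H₀₁ H₁₀ ≤ 0`. -/
theorem det_hess_nonpos_of_posDef (m : ℕ) (A : Fin 2 → Matrix (Fin m) (Fin m) ℝ) (hA : ∀ l, (A l).PosDef)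
    (γ : Fin 2 → ℕ)
    (hγ : γ ∈ (Fintype.piFinset fun _ : Fin 2 => Finset.range (m - 2 + 1)).filter (fun γ => ∑ i, γ i = m - 2)) :
    let H : Matrix (Fin 2) (Fin 2) ℝ := fun i j =>
      ((∏ l, ((γ + Pi.single i 1 + Pi.single j 1 : Fin 2 → ℕ) l).factorial : ℕ) : ℝ) *
        MvPolynomial.coeff (Finsupp.equivFunOnFinite.symm (γ + Pi.single i 1 + Pi.single j 1))
          (Matrix.det (∑ l, (MvPolynomial.X l : MvPolynomial (Fin 2) ℝ) • (A l).map MvPolynomial.C))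
    H 0 0 * H 1 1 - H 0 1 * H 1 0 ≤ 0 := by
  intro H
  have hAMO := atMostOnePosEig_hessAt_detArray_pencilTwo m A hA γ hγ
  have hsymm : H 0 1 = H 1 0 := by
    show ((∏ l, ((γ + Pi.single 0 1 + Pi.single 1 1 : Fin 2 → ℕ) l).factorial : ℕ) : ℝ) * _ =
      ((∏ l, ((γ + Pi.single 1 1 + Pi.single 0 1 : Fin 2 → ℕ) l).factorial : ℕ) : ℝ) * _
    rw [show γ + Pi.single 0 1 + Pi.single 1 1 = γ + Pi.single 1 1 + Pi.single 0 1 from by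
      rw [add_assoc, add_assoc, add_comm (Pi.single 0 1)]]
  have hnn : ∀ i j, 0 ≤ H i j := fun i j =>
    mul_nonneg (Nat.cast_nonneg _) (DetLorentzian.detArray_nonneg_of_posSemidef m 2 A (fun l => (hA l).posSemidef) _)
  -- test the reverse Cauchy–Schwarz on the coordinate vectors
  have hvHv : ∀ a b : Fin 2, (Pi.single a (1 : ℝ)) ⬝ᵥ (H *ᵥ Pi.single b 1) = H a b := by
    intro a b
    simp [Matrix.mulVec, dotProduct, Pi.single_apply]
  rcases (hnn 0 0).eq_or_lt with h00 | h00
  · rw [← h00, zero_mul, ← hsymm]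
    nlinarith [sq_nonneg (H 0 1)]
  · have h := hAMO (Pi.single 0 1) (Pi.single 1 1) (by rw [hvHv]; exact h00)
    rw [hvHv, hvHv, hvHv] at h
    rw [← hsymm]
    nlinarith [h]

/-! ## 3. Clause (d) for `K = 2`, semidefinite pairs -/

/-- **Clause (d) of `IsLorentzianArray m 2 (detArray m 2 A)` for positive SEMIDEFINITE `A₀, A₁`** (the line's
`layer`, `hessAt`, `factWeight`, `detArray`, `AtMostOnePosEig` unfolded), by the limit `A_l + ε·1 → A_l` from the
definite case. -/
theorem atMostOnePosEig_hessAt_detArray_pencilTwo_semidef (m : ℕ) (A : Fin 2 → Matrix (Fin m) (Fin m) ℝ)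
    (hA : ∀ l, (A l).PosSemidef) :
    ∀ γ ∈ (Fintype.piFinset fun _ : Fin 2 => Finset.range (m - 2 + 1)).filter (fun γ => ∑ i, γ i = m - 2),
      ∀ v w : Fin 2 → ℝ,
        0 < v ⬝ᵥ ((fun i j : Fin 2 =>
              ((∏ l, ((γ + Pi.single i 1 + Pi.single j 1 : Fin 2 → ℕ) l).factorial : ℕ) : ℝ) *
                MvPolynomial.coeff (Finsupp.equivFunOnFinite.symm (γ + Pi.single i 1 + Pi.single j 1))
                  (Matrix.det (∑ l, (MvPolynomial.X l : MvPolynomial (Fin 2) ℝ) • (A l).map MvPolynomial.C))) *ᵥ v) →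
        (v ⬝ᵥ ((fun i j : Fin 2 =>
              ((∏ l, ((γ + Pi.single i 1 + Pi.single j 1 : Fin 2 → ℕ) l).factorial : ℕ) : ℝ) *
                MvPolynomial.coeff (Finsupp.equivFunOnFinite.symm (γ + Pi.single i 1 + Pi.single j 1))
                  (Matrix.det (∑ l, (MvPolynomial.X l : MvPolynomial (Fin 2) ℝ) • (A l).map MvPolynomial.C))) *ᵥ v)) *
          (w ⬝ᵥ ((fun i j : Fin 2 =>
              ((∏ l, ((γ + Pi.single i 1 + Pi.single j 1 : Fin 2 → ℕ) l).factorial : ℕ) : ℝ) *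
                MvPolynomial.coeff (Finsupp.equivFunOnFinite.symm (γ + Pi.single i 1 + Pi.single j 1))
                  (Matrix.det (∑ l, (MvPolynomial.X l : MvPolynomial (Fin 2) ℝ) • (A l).map MvPolynomial.C))) *ᵥ w)) ≤
          (v ⬝ᵥ ((fun i j : Fin 2 =>
              ((∏ l, ((γ + Pi.single i 1 + Pi.single j 1 : Fin 2 → ℕ) l).factorial : ℕ) : ℝ) *
                MvPolynomial.coeff (Finsupp.equivFunOnFinite.symm (γ + Pi.single i 1 + Pi.single j 1))
                  (Matrix.det (∑ l, (MvPolynomial.X l : MvPolynomial (Fin 2) ℝ) • (A l).map MvPolynomial.C))) *ᵥ w)) ^ 2 := by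
  classical
  intro γ hγ
  -- the perturbed (definite) tuples and their coefficient arrays
  set Aε : ℝ → Fin 2 → Matrix (Fin m) (Fin m) ℝ := fun ε l => A l + ε • (1 : Matrix (Fin m) (Fin m) ℝ) with hAε
  set cε : ℝ → (Fin 2 → ℕ) → ℝ := fun ε α => MvPolynomial.coeff (Finsupp.equivFunOnFinite.symm α)
    (Matrix.det (∑ l, (MvPolynomial.X l : MvPolynomial (Fin 2) ℝ) • (Aε ε l).map MvPolynomial.C)) with hcε
  set Hε : ℝ → Matrix (Fin 2) (Fin 2) ℝ := fun ε i j =>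
    ((∏ l, ((γ + Pi.single i 1 + Pi.single j 1 : Fin 2 → ℕ) l).factorial : ℕ) : ℝ) *
      cε ε (γ + Pi.single i 1 + Pi.single j 1) with hHε
  have hA0 : Aε 0 = A := by funext l; simp [hAε]
  -- at ε = 0 the matrix in the statement is Hε 0
  have hH0 : (fun i j : Fin 2 =>
      ((∏ l, ((γ + Pi.single i 1 + Pi.single j 1 : Fin 2 → ℕ) l).factorial : ℕ) : ℝ) *
        MvPolynomial.coeff (Finsupp.equivFunOnFinite.symm (γ + Pi.single i 1 + Pi.single j 1))
          (Matrix.det (∑ l, (MvPolynomial.X l : MvPolynomial (Fin 2) ℝ) • (A l).map MvPolynomial.C))) = Hε 0 := by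
    funext i j; simp only [hHε, hcε, hA0]
  rw [hH0]
  have hsymm : Hε 0 0 1 = Hε 0 1 0 := by
    simp only [hHε]
    rw [show γ + Pi.single 0 1 + Pi.single 1 1 = γ + Pi.single 1 1 + Pi.single 0 1 from by
      rw [add_assoc, add_assoc, add_comm (Pi.single 0 1)]]
  refine atMostOnePosEig_of_det_nonpos (Hε 0) hsymm ?_
  -- definite perturbations: det ≤ 0 for every ε > 0
  have hpos : ∀ ε : ℝ, 0 < ε → ∀ l, (Aε ε l).PosDef := by
    intro ε hε l
    simp only [hAε]
    refine Matrix.PosDef.posSemidef_add (hA l) ?_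
    rw [show ε • (1 : Matrix (Fin m) (Fin m) ℝ) = Matrix.diagonal fun _ => ε by
      ext p q; by_cases hpq : p = q <;> simp [hpq]]
    exact Matrix.posDef_diagonal_iff.mpr fun _ => hε
  have hdetε : ∀ ε : ℝ, 0 < ε → Hε ε 0 0 * Hε ε 1 1 - Hε ε 0 1 * Hε ε 1 0 ≤ 0 := fun ε hε =>
    det_hess_nonpos_of_posDef m (Aε ε) (hpos ε hε) γ hγ
  -- continuity of every entry of Hε in ε, through the univariate bridge
  simp only [Finset.mem_filter, Fintype.mem_piFinset, Finset.mem_range, Fin.sum_univ_two] at hγ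
  obtain ⟨hγr, hγs⟩ := hγ
  have hcont : ∀ i j : Fin 2, Continuous fun ε => Hε ε i j := by
    intro i j
    simp only [hHε]
    refine continuous_const.mul ?_
    -- the multi-index γ + e_i + e_j is ![a, m'] with a + b = m (when m ≥ 2) — otherwise the coefficient is 0
    rcases lt_or_ge m 2 with hm | hm
    · have hz : ∀ ε, cε ε (γ + Pi.single i 1 + Pi.single j 1) = 0 := by
        intro ε
        apply DetLorentzian.detArray_eq_zero_of_not_mem_layer
        simp only [Finset.mem_filter, Fintype.mem_piFinset, Finset.mem_range, Fin.sum_univ_two, not_and]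
        intro _
        rw [add_single_single_eq]
        simp only [Matrix.cons_val_zero, Matrix.cons_val_one]
        fin_cases i <;> fin_cases j <;> simp <;> omega
      simp_rw [hz]; exact continuous_const
    · -- write the index as ![a, m - a] and use the bridge + polynomial dependence on ε
      set a : ℕ := γ 0 + (if i = 0 then 1 else 0) + (if j = 0 then 1 else 0) with ha
      have ham : a ≤ m := by rw [ha]; split_ifs <;> omega
      have h1 : γ 1 + (if i = 1 then 1 else 0) + (if j = 1 then 1 else 0) = m - a := by
        rw [ha]; fin_cases i <;> fin_cases j <;> simp <;> omega
      have hidx : γ + Pi.single i 1 + Pi.single j 1 = ![a, m - a] := by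
        rw [add_single_single_eq, ← ha, h1]
      have hbridge : ∀ ε, cε ε (γ + Pi.single i 1 + Pi.single j 1) =
          ((X : ℝ[X]) • (A 0 + ε • (1 : Matrix (Fin m) (Fin m) ℝ)).map C +
            (A 1 + ε • (1 : Matrix (Fin m) (Fin m) ℝ)).map C).det.coeff a := by
        intro ε
        rw [hidx, hcε]
        exact (coeff_det_pencil_eq_detArray (Aε ε) a ham).symm
      simp_rw [hbridge]
      exact coeff_det_pencil_perturb_continuous (A 0) (A 1) 1 1 a
  have hdetcont : Continuous fun ε => Hε ε 0 0 * Hε ε 1 1 - Hε ε 0 1 * Hε ε 1 0 :=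
    ((hcont 0 0).mul (hcont 1 1)).sub ((hcont 0 1).mul (hcont 1 0))
  -- pass to the limit ε → 0⁺
  have hlim : Tendsto (fun ε => Hε ε 0 0 * Hε ε 1 1 - Hε ε 0 1 * Hε ε 1 0) (𝓝[>] (0 : ℝ))
      (𝓝 (Hε 0 0 0 * Hε 0 1 1 - Hε 0 0 1 * Hε 0 1 0)) :=
    (hdetcont.tendsto 0).mono_left nhdsWithin_le_nhds
  exact le_of_tendsto hlim (eventually_nhdsWithin_of_forall fun ε hε => hdetε ε hε)

end PencilTwo

end Summit.ValiantsHypothesis.ValiantsHypothesis.Theorems.LacunarySymmetroidMatrixDescartes
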